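import Summits.Ventures.YMGap.RobustBall.WilsonStringTension
import Summits.Ventures.YMGap.Census.DecimationStrict
import Summits.Ventures.YMGap.Census.InterpolationAlphaCrossing
import Summits.Ventures.YMGap.RobustBall.MassGapOnBallZdGRows
import Summits.Ventures.YMGap.RobustBall.MassGapOnBallZdGMassive
import HarnessLib

/-!
# Venture statement — YMGap (cell `pub-ymgap`) — CONJUNCT BODIES T34, T35, T36 (DRAFT for the lead's booking; seat p3-g4)

STATUS: DRAFT. T34 = seat rb-p2 (g3)'s candidate T-texts (`HOME/rb/lean-rb-p2/T-texts-rbp2g3.lean` 1487a6928de554ce) consolidated into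
ONE conjunct; T35 = the track-(b) «interpolation parameter» texts over seat lit-2 (g11)'s landings; T36 = the Y2 SPRINT POINT OF RECORD
(lead 06:19:05Z): the mass gap uniformly on the GAUGE-INVARIANT tier-1 `ℤ⁴` ball at `β⋆_W = 1/8`, `ε = 0.148` (seat ds-2's robust vertex-star
door) with its massive-state twin (seat ds-3). Goes to the gate only on a lead booking; the index entry
`YMGapStatementV1_8 := YMGapStatementV1_7 ∧ …` is appended to `StatementIndex.lean` (PLAN R215) afterwards.
T29 (track Y4) stays reserved for the Sunday item-(15) ruling.

HONEST FRAMING. WHAT THIS IS: bodies `Tk_… : Prop` + witnesses `Tk_…_holds` of three conjuncts of the venture statement (index of record: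
`Summits/Ventures/YMGap/Statement.lean` frozen at v1.6, continued in `StatementIndex.lean`). All three are kernel-checked and carry NO hypothesis.
* **T34** (strong coupling, Wilson action, LIMIT STATES): for lattice `SU(N)` Yang–Mills, every infinite-volume LIMIT POINT `μ` of the torus
  Wilson states — (i) at EVERY coupling `β > 0`, every `N ≥ 2`, `d ≥ 2`: the fundamental string tension `σ(μ) ≥ 0` EXISTS
  (`HasStringTension`); (ii) `SU(2)`, every `d ≥ 2`, `0 < β_W < 2/(d−1)` (tree coupling `β_W/2`): `μ` CONFINES (`IsConfining`: its string tension
  exists and is `> 0`); in particular `d = 4`, `0 < β_W < 2/3`; (iii) every `N ≥ 2`, `d ≥ 2`, 't Hooft `0 < β < 1/(8(d−1))` (tree coupling `Nβ`):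
  `μ` confines. Texts: seat rb-p2 (plaquette positivity at every coupling + the Durhuus–Fröhlich / Cao–Nissim–Sheffield windows already in the tree).
  LATTICE statements about limit points of the torus Wilson states; NOT about non-Wilson members of the Y2 balls; the windows are where the
  area-law BOUNDS close; nothing continuum, nothing spectral.
* **T35** (track (b)): Tomboulis's INTERPOLATION PARAMETERS exist and are unique, as printed (arXiv:0707.2179 §3.2 (3.23)–(3.24), §4 (4.18)–(4.19),
  "there exist a value `0 < α < 1`"), for ONE decimation step on the positivity domain: for `d ≥ 3`, `b ≥ 2`, even coarse side `L`, every cut-off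
  `J`, admissible `c` with `f_c ≥ 0` and some `c_j > 0`, every `0 ≤ r ≤ 1` and every `t > 0` there is a UNIQUE `α_Λ(t,r) ∈ (0,1)` with
  `Z̃(α, t) = Z_Λ` and a UNIQUE `α⁺_Λ(t,r) ∈ (0,1)` with `Z̃⁺(α⁺, t) = Z⁺_Λ` (strict potential moving ⇒ strict III.1 / IV.3 ⇒ IVT; uniqueness by
  the bulk factor `F₀^U > 1`); and the CROSSING CRITERION: two opposite orderings of `(Z_Λ, Z̃(a₁,t₁))`, `(Z⁺_Λ, Z̃⁺(a₁,t₁))` and at `(a₂,t₂)`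
  imply Ito–Seiler's Problem 2 for that instance (`ISProblem2`, a common `α_Λ(t*) = α⁺_Λ(t*)`). Finite tori; NOTHING is asserted about whether a
  crossing occurs for any instance, about (5.15)/(5.16), the thermodynamic limit or confinement. Texts: seat lit-2.
* **T36** (track Y2, the sprint point of record): `SU(2)`, `d = 4`, the GAUGE-INVARIANT tier-1 `ℤ⁴` ball `RobustBall.MemBallZdG ε₀ ε₁ R` (continuous,
  adapted, locally finite, range-`R`, lattice-gauge-invariant link potentials; oscillation load `≤ ε₀`, SITE-incidence Lipschitz load `≤ ε₁` — the
  loads of the torus ball `ClusterDomainFR` read on `ℤ⁴`): (i) the row of record `(β⋆_W, ε) = (1/8, 37/250)`: `MassGapOnBallZdG 4 2 (1/32) (37/125)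
  (37/250) R` for every range `R` — every member added to the `SU(2)` Wilson action at `β_W = 1/8` has exactly one DLR state, exponentially clustering
  (robust vertex-star door; seat ds-2); (ii) the row `(1/3, 3/250)` and UP TO `β_W = 1/3`: `MassGapOnBallZdG 4 2 (β_W/4) (3/125) (3/250) R` for every
  `0 ≤ β_W ≤ 1/3`; the Wilson point `MassGapAt 4 2 (1/12)` as the zero member; (iii) the conversion, every `N ≥ 1`: `MassGapOnBallZdG 4 N β ε₀ ε₁ R ⇒`
  every member has DLR states, all MASSIVE with plaquette–plaquette decay (seat ds-3). Radii are door artefacts; lattice; nothing continuum.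
WHAT THIS IS NOT: no continuum statement, no spectral gap, no verdict on Tomboulis's (5.15) or Ito–Seiler's Problem 2 for any instance, no claim on
the Yang–Mills Millennium problem.
-/

noncomputable section

namespace Summit.Ventures.YMGap

open MeasureTheory
open Literature.MathematicalPhysics.QuantumLattice Literature.MathematicalPhysics.QuantumFieldTheory
open Literature.MathematicalPhysics.QuantumFieldTheory.Tomboulis2007
open Literature.Probability.LatticeModels (HasExponentialDecay Potential)
open Literature.Barriers.QuantumFields (IsMassiveState)

/-- **T34 — strong coupling, Wilson action: THE STRING TENSION EXISTS AT EVERY COUPLING, and CONFINEMENT ON THE CERTIFIED WINDOWS,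
for every infinite-volume LIMIT POINT of the torus Wilson states, UNCONDITIONAL** (`infiniteVolumeLimitPoints ρ β`: weak limit points
of the torus Wilson states lifted to `ℤ^d`; `χ_N = Re tr/N` the normalised fundamental character): (i) every `N ≥ 2`, `d ≥ 2`, tree
coupling `β > 0`, every limit point `μ`: `∃ σ ≥ 0, HasStringTension μ χ_N σ` — the fundamental string tension EXISTS
(`RobustBall.WilsonStringTension.suN_hasStringTension`; via plaquette positivity at every coupling); (ii) `SU(2)`, every `d ≥ 2`, Wilson
`0 < β_W < 2/(d−1)` (tree coupling `β_W/2`): every limit point CONFINES, `IsConfining μ χ₂` (string tension exists and is `> 0`)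
(`…su2_isConfining`); (iii) the `d = 4` instance `0 < β_W < 2/3` (`…su2_isConfining_dim4`; T5's area-law window); (iv) every `N ≥ 2`,
`d ≥ 2`, 't Hooft `0 < β < 1/(8(d−1))` (tree coupling `N·β`): every limit point confines (`…suN_isConfining_cns`; the Cao–Nissim–Sheffield
window). Texts: seat rb-p2. LATTICE statements about limit points of Wilson states; the windows are where area-law bounds close; nothing
continuum, nothing spectral, nothing about non-Wilson perturbations. -/
def T34_WilsonStringTensionConfinement : Prop :=
  (∀ (d N : ℕ) [NeZero d], 2 ≤ N → 2 ≤ d → ∀ β : ℝ, 0 < β →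
      ∀ μ ∈ infiniteVolumeLimitPoints (d := d) (fundamentalRep (Fin N)) β,
        ∃ σ : ℝ, 0 ≤ σ ∧ HasStringTension μ (fun g => normalisedCharacter N (fundamentalRep (Fin N) g)) σ) ∧
    (∀ (d : ℕ) [NeZero d], 2 ≤ d → ∀ βW : ℝ, 0 < βW → βW < 2 / ((d : ℝ) - 1) →
      ∀ μ ∈ infiniteVolumeLimitPoints (d := d) (fundamentalRep (Fin 2)) (βW / 2),
        IsConfining μ (fun g => normalisedCharacter 2 (fundamentalRep (Fin 2) g))) ∧
    (∀ βW : ℝ, 0 < βW → βW < 2 / 3 →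
      ∀ μ ∈ infiniteVolumeLimitPoints (d := 4) (fundamentalRep (Fin 2)) (βW / 2),
        IsConfining μ (fun g => normalisedCharacter 2 (fundamentalRep (Fin 2) g))) ∧
    (∀ (d N : ℕ) [NeZero d], 2 ≤ N → 2 ≤ d → ∀ β : ℝ, 0 < β → β < 1 / (8 * ((d : ℝ) - 1)) →
      ∀ μ ∈ infiniteVolumeLimitPoints (d := d) (fundamentalRep (Fin N)) ((N : ℝ) * β),
        IsConfining μ (fun g => normalisedCharacter N (fundamentalRep (Fin N) g)))

/-- T34 holds (`RobustBall.WilsonStringTension.suN_hasStringTension`, `…su2_isConfining`, `…su2_isConfining_dim4`,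
`…suN_isConfining_cns`). -/
theorem T34_WilsonStringTensionConfinement_holds : T34_WilsonStringTensionConfinement :=
  ⟨fun _ _ _ hN hd _ hβ _ hμ => RobustBall.WilsonStringTension.suN_hasStringTension hN hd hβ hμ,
    fun _ _ hd _ hβ hlt _ hμ => RobustBall.WilsonStringTension.su2_isConfining hd hβ hlt hμ,
    fun _ hβ hlt _ hμ => RobustBall.WilsonStringTension.su2_isConfining_dim4 hβ hlt hμ,
    fun _ _ _ hN hd _ hβ hlt _ hμ => RobustBall.WilsonStringTension.suN_isConfining_cns hN hd hβ hlt hμ⟩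

/-- **T35 — track (b): Tomboulis's INTERPOLATION PARAMETERS EXIST AND ARE UNIQUE (T07 §3.2 (3.23)–(3.24), §4 (4.18)–(4.19) AS PRINTED),
and the CROSSING CRITERION for Ito–Seiler's Problem 2, UNCONDITIONAL** — one decimation step `(ℤ/bL)^d → (ℤ/L)^d`, `d ≥ 3`, `b ≥ 2`, EVEN
coarse side `L`, every cut-off `J`, admissible coefficients `c` with `f_c ≥ 0` on `SU(2)` and some `c_{n₀} > 0` (`1 ≤ n₀ ≤ J`), every
`0 ≤ r ≤ 1`: (i) STRICT Prop. III.1 — `Z_{(ℤ/bL)^d}({c_j}) < F₀^U(1)^{#plaquettes} · Z_{(ℤ/L)^d}({c^U_j(1,1)})` (every `L ≥ 1`; App. A §4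
"equality only in the trivial case"; `Census.decimationUpperBound_strict_of_nonneg`); (ii) for every `t > 0` a UNIQUE `α ∈ (0,1)` solves
`Z̃_{Λ^{(1)}}(α, t) = Z_Λ` (`IsAlpha d L b J r c t α`; `Census.existsUnique_isAlpha`); (iii) for every plane `i < j` and every `t > 0` a UNIQUE
`α⁺ ∈ (0,1)` solves `Z̃⁺_{Λ^{(1)}}(α⁺, t) = Z⁺_Λ(𝒱_{ij})` (`IsAlphaPlus`; `Census.existsUnique_isAlphaPlus`); (iv) the CROSSING CRITERION: if at
some `(a₁, t₁)` (`a₁ ∈ (0,1]`, `t₁ > 0`) `Z_Λ ≤ Z̃(a₁,t₁)` while `Z̃⁺(a₁,t₁) ≤ Z⁺_Λ`, and at some `(a₂, t₂)` the opposite two inequalities hold,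
then `ISProblem2 L b J r i j _ c` — a common solution `α_Λ(t*) = α⁺_Λ(t*)` exists (`Census.isProblem2_holds_of_crossing`; continuity of the
unique selections + the intermediate value theorem). The shape in which two certified sign evaluations decide Problem 2 for ONE instance;
NOTHING is asserted about whether the crossing hypotheses hold for any instance, about (5.15)/(5.16), limits or confinement. Texts: seat lit-2. -/
def T35_TomboulisInterpolationParameter : Prop :=
  ∀ (d L b : ℕ) [NeZero b] [NeZero L], 3 ≤ d → 2 ≤ b → ∀ (J : ℕ) (c : ℕ → ℝ), CoeffAdmissible c →
    (∀ g : Tomboulis2007.SU2, 0 ≤ plaqFn J c g) → ∀ n₀ : ℕ, n₀ ∈ Finset.Icc 1 J → 0 < c n₀ →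
      (torusZ d (b * L) J c <
          mkF0 J c (b ^ (d - 2)) b ^ Fintype.card (Plaquette d L) *
            torusZ d L (b ^ (d - 2) * J) (mkCoeff J c (b ^ (d - 2)) b 1)) ∧
      (Even L → ∀ r : ℝ, 0 ≤ r → r ≤ 1 →
        (∀ t : ℝ, 0 < t → ∃! α : ℝ, IsAlpha d L b J r c t α) ∧
        (∀ (i j : Fin d) (hij : i < j), ∀ t : ℝ, 0 < t → ∃! α : ℝ, IsAlphaPlus L b J r i j hij c t α) ∧
        (∀ (i j : Fin d) (hij : i < j) (t₁ t₂ a₁ a₂ : ℝ), 0 < t₁ → 0 < t₂ → a₁ ∈ Set.Ioc (0 : ℝ) 1 → a₂ ∈ Set.Ioc (0 : ℝ) 1 →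
          torusZ d (b * L) J c ≤ tildeZ d L b J r c a₁ t₁ →
          tildeZplus L b J r i j hij c a₁ t₁ ≤ torusZplus d (b * L) J c (vortexSheet (b * L) i j hij) →
          tildeZ d L b J r c a₂ t₂ ≤ torusZ d (b * L) J c →
          torusZplus d (b * L) J c (vortexSheet (b * L) i j hij) ≤ tildeZplus L b J r i j hij c a₂ t₂ →
            ISProblem2 L b J r i j hij c))

/-- T35 holds (`Census.decimationUpperBound_strict_of_nonneg`, `Census.existsUnique_isAlpha`, `Census.existsUnique_isAlphaPlus`,
`Census.isProblem2_holds_of_crossing`). -/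
theorem T35_TomboulisInterpolationParameter_holds : T35_TomboulisInterpolationParameter :=
  fun _ _ _ _ _ hd hb J _ hc hf _ hn₀ hpos =>
    ⟨Census.decimationUpperBound_strict_of_nonneg hd hb J hc hf hn₀ hpos,
      fun hL _ hr0 hr1 =>
        ⟨fun _ ht => Census.existsUnique_isAlpha hd hb hL J hc hf hn₀ hpos hr0 hr1 ht,
          fun _ _ hij _ ht => Census.existsUnique_isAlphaPlus hd hb hL hij J hc hf hn₀ hpos hr0 hr1 ht,
          fun _ _ hij _ _ _ _ ht₁ ht₂ ha₁ ha₂ h1Z h1P h2Z h2P =>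
            Census.isProblem2_holds_of_crossing hd hb hL J hij hc hf hn₀ hpos hr0 hr1 ht₁ ht₂ ha₁ ha₂ h1Z h1P h2Z h2P⟩⟩

/-- **T36 — track Y2, THE SPRINT POINT OF RECORD: the MASS GAP UNIFORMLY ON THE GAUGE-INVARIANT TIER-1 `ℤ⁴` BALL, `SU(2)`, `d = 4`,
HYPOTHESIS-FREE** ('t Hooft coupling `β_W/4`; `MassGapOnBallZdG 4 2 β ε₀ ε₁ R`: every member `(W, supp)` of `RobustBall.MemBallZdG ε₀ ε₁ R` —
continuous, adapted, locally finite, range-`R`, LATTICE-GAUGE-INVARIANT link potentials with oscillation load `≤ ε₀` and site-incidence Lipschitz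
load `≤ ε₁` — added to the Wilson action has exactly one DLR state, exponentially clustering): (i) the row of record `(β⋆_W, ε) = (1/8, 37/250)`,
radii `(2ε, ε) = (37/125, 37/250)`, every range `R`: `MassGapOnBallZdG 4 2 (1/32) (37/125) (37/250) R`
(`RobustBall.su2_massGapOnBallZdG_star_oneEighth`, robust vertex-star door, seat ds-2); (ii) UP TO `β_W = 1/3` on the ball `(3/125, 3/250)`:
`MassGapOnBallZdG 4 2 (β_W/4) (3/125) (3/250) R` for every `0 ≤ β_W ≤ 1/3`, every `R` (`…su2_massGapOnBallZdG_star_upTo_oneThird`), and the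
Wilson point `MassGapAt 4 2 (1/12)` as its zero member (`…su2_massGapAt_oneThird_of_ball`); (iii) the conversion, every `N ≥ 1`:
`MassGapOnBallZdG 4 N β ε₀ ε₁ R ⇒` every member has DLR states and EVERY one of them is MASSIVE (`IsMassiveState`) with exponentially decaying
plaquette–plaquette correlation function (`RobustBall.massive_onBallZdG`, seat ds-3). Radii are door artefacts; lattice strong coupling;
nothing continuum. -/
def T36_SU2GaugeInvariantBallMassGap : Prop :=
  (∀ R : ℕ, RobustBall.MassGapOnBallZdG 4 2 (1 / 32) (37 / 125) (37 / 250) R) ∧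
    ((∀ βW : ℝ, 0 ≤ βW → βW ≤ 1 / 3 → ∀ R : ℕ, RobustBall.MassGapOnBallZdG 4 2 (βW / 4) (3 / 125) (3 / 250) R) ∧
      MassGapAt 4 2 (1 / 12)) ∧
    (∀ N : ℕ, 1 ≤ N → ∀ (β ε₀ ε₁ : ℝ) (R : ℕ), RobustBall.MassGapOnBallZdG 4 N β ε₀ ε₁ R →
      ∀ (W : Potential (Literature.MathematicalPhysics.QuantumLattice.ZdEdge 4) (Matrix.specialUnitaryGroup (Fin N) ℂ))
        (supp : Finset (Literature.MathematicalPhysics.QuantumLattice.ZdEdge 4) → Finset (Finset (Literature.MathematicalPhysics.QuantumLattice.ZdEdge 4))),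
        RobustBall.MemBallZdG ε₀ ε₁ R W supp →
        (RobustBall.perturbedGibbsMeasures (d := 4) (fundamentalRep (Fin N)) ((N : ℝ) * β) W supp).Nonempty ∧
          ∀ μ ∈ RobustBall.perturbedGibbsMeasures (d := 4) (fundamentalRep (Fin N)) ((N : ℝ) * β) W supp,
            IsMassiveState μ ∧ HasExponentialDecay (plaquetteCorrFn (fundamentalRep (Fin N)) μ))

/-- T36 holds (`RobustBall.su2_massGapOnBallZdG_star_oneEighth`, `RobustBall.su2_massGapOnBallZdG_star_upTo_oneThird`,
`RobustBall.su2_massGapAt_oneThird_of_ball`, `RobustBall.massive_onBallZdG`). -/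
theorem T36_SU2GaugeInvariantBallMassGap_holds : T36_SU2GaugeInvariantBallMassGap :=
  ⟨RobustBall.su2_massGapOnBallZdG_star_oneEighth,
    ⟨fun _ h0 h R => RobustBall.su2_massGapOnBallZdG_star_upTo_oneThird h0 h R, RobustBall.su2_massGapAt_oneThird_of_ball⟩,
    fun _ hN _ _ _ _ h _ _ hmem => RobustBall.massive_onBallZdG hN h hmem⟩

end Summit.Ventures.YMGap

end
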